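import Summits.ValiantsHypothesis.ValiantsHypothesis.Theorems.GrenetZeonDualUnipotentThreeHalvesHeavyTopInstFourSevenToolkit

/-!
# `GrenetZeon.DualUnipotentThreeHalves` (stmt-ValiantsHypothesis-24318), R2 `HeavyTopLaw` instance grid — COORDINATE PATTERN PENCILS:
# definitions, the pattern pencil, ring-generic words, Lemma B (no cancellation on paths), torus intertwining, path placements

Experiment cell «val-heavytop-census» (D-0160), engine seat val-htc-eng-2 (g2).  First half of the kernel port of val-idea-28 g3's
`Cruxes/DualUnipotentThreeHalves/MEMO-g3-degenerate-certificate.md` (Lemma A «the direction space of a pattern pencil may be taken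
COORDINATE», Lemma B «no cancellation on paths», in their S3 / path form) = the UNIFORM NEGATIVE CRITERION of the `HeavyTopInst n m` grid:
a pattern pencil whose placement digraph carries `n` edge-disjoint directed paths of length `n − 1` is NOT flag-cheap, whence
`¬ HeavyTopInst n m` for `n ≤ 16` (`…HeavyTopPatternPlacement`: Lemma A + `not_heavyTopInst_of_placement`; instances `(5,10)`, `(5,11)`,
`(6,12..14)`, `(7,15..18)` in `…DualUnipotentThreeHalves/Negative/HeavyTopInst{FiveTen,SixTwelve,SevenFifteen}`).

A COORDINATE PATTERN places the `n²` coordinates of `ℂ^{n×n}` at entries of an `m × m` matrix, `pos : Fin n × Fin n → Fin m × Fin m`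
(injective and strictly upper in every use; not baked into the definitions).  This file:

* DEFINITIONS `patTop pos v` (entry `v c` at `pos c`; ring-generic, so that the `0/1` letters over `ℕ` of Lemma B and the polynomial
  families over `ℂ[X]` of Lemma A are the same object as the complex tops), `patPencil pos : AffMat n m` (the LINEAR pattern pencil,
  `N(x) = patTop pos x`), `gword T₀ T₁ w` (the word of a Boolean list over ANY semiring; `word = gword` over `ℂ`, `rfl`), `wt pos c = 2^j − 2^i`
  for `pos c = (i,j)` (torus weight), `placement V X` (the PATH PLACEMENT: coordinate `(a, i)`, `i < s`, at the `i`-th edge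
  `(V a i, V a (i+1))` of the `a`-th vertex sequence, `(a, s)` at the extra entry `X a`).
* `patTop_map/_apply_pos/_apply_eq_zero_of_le/_zero/_add/_smul`; `patPencil_map_eval` (`N(x) = patTop x`), `linPart_patPencil`
  (`N_lin(v) = patTop v`), `isAffine_patPencil`, `patPencil_pow_eq_zero` (strictly upper ⇒ `N^m = 0`).
* `gword_map` (ring homomorphisms), `gword_intertwine` / `gword_eq_zero_iff_of_intertwine` (**torus intertwining**: `D·A' = A·D`,
  `D·B' = B·D` ⇒ `D·w(A',B') = w(A,B)·D`, so an invertible `D` transports the vanishing of words).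
* ★ **Lemma B** `word_indicator_ne_zero_of_isChain`: for the all-ones top `A_D` and the indicator top `A_E` of a coordinate set `E`, the
  word read along a directed path of the placement digraph (letter `A_E` on the edges in `E`, `A_D` elsewhere) is NONZERO — over `ℕ`
  every summand is `≥ 0` and the path itself contributes `1` (`one_le_gword_apply_of_isChain`), then cast to `ℂ`.
* `placement_apply_lt`, `isChain_rowPath` (the rows of a placement are directed paths), `count_true_ofFn`.

`--supports stmt-ValiantsHypothesis-24318`.  Nothing here asserts or refutes R2 `HeavyTopLaw`, the crux, rung 8062 or `VP ≠ VNP` — all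
OPEN / NOT proved.  [MEMO-g3 §1–§2, §7 (P1–P4); ✓ `…WordFlagPencil`, ✓ `…Negative.HeavyTopInstThreeFive` (`pow_eq_zero_of_strictUpper`); this seat]
-/

-- `Summit.ValiantsHypothesis.ValiantsHypothesis.…` repeats a component (D-0017 layout); `dupNamespace` would flag the mandated name.
set_option linter.dupNamespace false
set_option autoImplicit false

noncomputable section

namespace Summit.ValiantsHypothesis.ValiantsHypothesis.Theorems.GrenetZeon.RadicalSplit

open MvPolynomial Matrix
open scoped BigOperators
open Summit.ValiantsHypothesis.ValiantsHypothesis.Cruxes.TwoDimCoefficients.DimTwoCases (AffMat IsAffine)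

/-- The PLACEMENT TOP MAP: the `m × m` matrix whose entry at `(i, j)` is the sum of `v c` over the coordinates `c` placed at
`(i, j)` (for an injective placement: `v c` at `pos c`, zero off the pattern).  Ring-generic. -/
def patTop {n m : ℕ} {R : Type*} [AddCommMonoid R] (pos : Fin n × Fin n → Fin m × Fin m) (v : Fin n × Fin n → R) :
    Matrix (Fin m) (Fin m) R :=
  fun i j => ∑ c, if pos c = (i, j) then v c else 0

/-- The COORDINATE PATTERN PENCIL of a placement: the linear `m × m` pencil over `ℂ^{n×n}` with `N(x) = patTop pos x`
(entry `X c` at `pos c`, constant part `0`). -/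
def patPencil {n m : ℕ} (pos : Fin n × Fin n → Fin m × Fin m) : AffMat n m :=
  patTop pos fun c => (MvPolynomial.X c : MvPolynomial (Fin n × Fin n) ℂ)

/-- The word of a Boolean list in two matrices over any semiring (`true ↦ T₁`, `false ↦ T₀`). -/
def gword {m : ℕ} {R : Type*} [Semiring R] (T₀ T₁ : Matrix (Fin m) (Fin m) R) (w : List Bool) : Matrix (Fin m) (Fin m) R :=
  (w.map fun b => if b then T₁ else T₀).prod

/-- `word` (the `ℂ`-valued word of `…WordDefs`) is `gword`. -/
theorem word_eq_gword {m : ℕ} (T₀ T₁ : Matrix (Fin m) (Fin m) ℂ) (w : List Bool) : word T₀ T₁ w = gword T₀ T₁ w := rfl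

/-- The TORUS WEIGHT of a coordinate: `2^j − 2^i` for `pos c = (i, j)` — conjugation by `diag(t^{2^i})` scales the entry `(i, j)`
of a top by `t^{2^j − 2^i}`; for an injective strictly upper placement distinct coordinates have distinct weights. -/
def wt {n m : ℕ} (pos : Fin n × Fin n → Fin m × Fin m) (c : Fin n × Fin n) : ℕ :=
  2 ^ ((pos c).2 : ℕ) - 2 ^ ((pos c).1 : ℕ)

/-- The PATH PLACEMENT of `s + 1` vertex sequences `V a : Fin (s+1) → Fin m` and `s + 1` extra entries `X a`: coordinate `(a, i)`,
`i < s`, sits at the edge `(V a i, V a (i+1))`; coordinate `(a, s)` at `X a` (a `dite` on `i < s`, so that `decide` evaluates concrete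
placements).  When consecutive path vertices increase, the `X a` are strictly upper and all `(s+1)²` entries are distinct, the placement
digraph carries the `s + 1` edge-disjoint directed `s`-paths `a ↦ [(a,0), …, (a,s−1)]` — the certificate of `not_heavyTopInst_of_placement`. -/
def placement {s m : ℕ} (V : Fin (s + 1) → Fin (s + 1) → Fin m) (X : Fin (s + 1) → Fin m × Fin m) :
    Fin (s + 1) × Fin (s + 1) → Fin m × Fin m :=
  fun c => if h : (c.2 : ℕ) < s then (V c.1 ⟨c.2, by omega⟩, V c.1 ⟨c.2 + 1, by omega⟩) else X c.1


/-! ## The placement top map: entries, functoriality -/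

section PatTop

variable {n m : ℕ}

/-- `patTop` commutes with additive maps of the entries. -/
theorem patTop_map {R S F : Type*} [AddCommMonoid R] [AddCommMonoid S] [FunLike F R S] [AddMonoidHomClass F R S] (f : F)
    (pos : Fin n × Fin n → Fin m × Fin m) (v : Fin n × Fin n → R) :
    (patTop pos v).map f = patTop pos (fun c => f (v c)) := by
  ext i j
  simp only [patTop, Matrix.map_apply, map_sum]
  refine Finset.sum_congr rfl fun c _ => ?_
  split_ifs <;> simp

/-- Off the pattern the top vanishes. -/
theorem patTop_apply_of_ne {R : Type*} [AddCommMonoid R] (pos : Fin n × Fin n → Fin m × Fin m) (v : Fin n × Fin n → R)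
    {i j : Fin m} (h : ∀ c, pos c ≠ (i, j)) : patTop pos v i j = 0 :=
  Finset.sum_eq_zero fun c _ => if_neg (h c)

/-- On the pattern (injective placement) the top carries the coordinate. -/
theorem patTop_apply_pos {R : Type*} [AddCommMonoid R] (pos : Fin n × Fin n → Fin m × Fin m) (hinj : Function.Injective pos)
    (v : Fin n × Fin n → R) (c : Fin n × Fin n) : patTop pos v (pos c).1 (pos c).2 = v c := by
  simp only [patTop, Prod.mk.eta]
  rw [Finset.sum_eq_single c (fun c' _ hc' => if_neg fun h => hc' (hinj h)) (fun h => absurd (Finset.mem_univ c) h), if_pos rfl]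

/-- A strictly upper placement has strictly upper tops. -/
theorem patTop_apply_eq_zero_of_le {R : Type*} [AddCommMonoid R] (pos : Fin n × Fin n → Fin m × Fin m)
    (hup : ∀ c, (pos c).1 < (pos c).2) (v : Fin n × Fin n → R) {i j : Fin m} (h : (j : ℕ) ≤ i) : patTop pos v i j = 0 :=
  patTop_apply_of_ne pos v fun c hc => by
    have h1 := hup c
    rw [hc] at h1
    exact absurd (Fin.lt_def.1 h1) (by simpa using h)

/-- The zero top. -/
theorem patTop_zero {R : Type*} [AddCommMonoid R] (pos : Fin n × Fin n → Fin m × Fin m) :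
    patTop pos (0 : Fin n × Fin n → R) = 0 := by
  ext i j
  simp [patTop]

/-- The top map is additive. -/
theorem patTop_add {R : Type*} [AddCommMonoid R] (pos : Fin n × Fin n → Fin m × Fin m) (u v : Fin n × Fin n → R) :
    patTop pos (u + v) = patTop pos u + patTop pos v := by
  ext i j
  simp only [patTop, Matrix.add_apply, Pi.add_apply, ← Finset.sum_add_distrib]
  refine Finset.sum_congr rfl fun c _ => ?_
  split_ifs <;> simp

/-- The top map is homogeneous. -/
theorem patTop_smul {R : Type*} [CommSemiring R] (pos : Fin n × Fin n → Fin m × Fin m) (a : R) (v : Fin n × Fin n → R) :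
    patTop pos (a • v) = a • patTop pos v := by
  ext i j
  simp only [patTop, Matrix.smul_apply, Pi.smul_apply, smul_eq_mul, Finset.mul_sum]
  refine Finset.sum_congr rfl fun c _ => ?_
  split_ifs <;> simp

/-! ## The pattern pencil: values, tops, affinity, nilpotency -/

/-- The values of the pattern pencil: `N(x) = patTop pos x`. -/
theorem patPencil_map_eval (pos : Fin n × Fin n → Fin m × Fin m) (x : Fin n × Fin n → ℂ) :
    (patPencil pos).map (MvPolynomial.eval x) = patTop pos x := by
  unfold patPencil
  rw [patTop_map]
  simp

/-- The tops of the pattern pencil: `N_lin(v) = patTop pos v`. -/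
theorem linPart_patPencil (pos : Fin n × Fin n → Fin m × Fin m) (v : Fin n × Fin n → ℂ) :
    linPart (patPencil pos) v = patTop pos v := by
  unfold linPart
  rw [patPencil_map_eval, patPencil_map_eval, patTop_zero, sub_zero]

/-- The pattern pencil is affine (indeed linear). -/
theorem isAffine_patPencil (pos : Fin n × Fin n → Fin m × Fin m) : IsAffine (patPencil pos) := by
  intro i j
  simp only [patPencil, patTop]
  refine (MvPolynomial.totalDegree_finsetSum _ _).trans (Finset.sup_le fun c _ => ?_)
  split_ifs
  · exact (MvPolynomial.totalDegree_X (R := ℂ) c).le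
  · simp

/-- A strictly upper pattern pencil is strictly upper triangular … -/
theorem patPencil_strictUpper (pos : Fin n × Fin n → Fin m × Fin m) (hup : ∀ c, (pos c).1 < (pos c).2) :
    ∀ a b : Fin m, (b : ℕ) ≤ a → patPencil pos a b = 0 :=
  fun _ _ h => patTop_apply_eq_zero_of_le pos hup _ h

/-- … hence nilpotent: `N^m = 0`. -/
theorem patPencil_pow_eq_zero (pos : Fin n × Fin n → Fin m × Fin m) (hup : ∀ c, (pos c).1 < (pos c).2) :
    patPencil pos ^ m = 0 :=
  pow_eq_zero_of_strictUpper _ (patPencil_strictUpper pos hup)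

end PatTop

/-! ## Ring-generic words: functoriality and torus intertwining -/

section Words

variable {m : ℕ}

/-- The empty word is `1`. -/
theorem gword_nil {R : Type*} [Semiring R] (T₀ T₁ : Matrix (Fin m) (Fin m) R) : gword T₀ T₁ [] = 1 := by
  simp [gword]

/-- Prepending a letter multiplies on the left. -/
theorem gword_cons {R : Type*} [Semiring R] (T₀ T₁ : Matrix (Fin m) (Fin m) R) (b : Bool) (w : List Bool) :
    gword T₀ T₁ (b :: w) = (if b then T₁ else T₀) * gword T₀ T₁ w := by
  simp [gword]

/-- Words commute with ring homomorphisms of the entries. -/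
theorem gword_map {R S : Type*} [Semiring R] [Semiring S] (f : R →+* S) (T₀ T₁ : Matrix (Fin m) (Fin m) R) (w : List Bool) :
    (gword T₀ T₁ w).map f = gword (T₀.map f) (T₁.map f) w := by
  induction w with
  | nil => rw [gword_nil, gword_nil, Matrix.map_one f (map_zero f) (map_one f)]
  | cons b w ih =>
    rw [gword_cons, gword_cons, Matrix.map_mul, ih]
    cases b <;> simp

/-- **Torus intertwining.**  If `D` intertwines the letters (`D·A' = A·D`, `D·B' = B·D`) it intertwines every word. -/
theorem gword_intertwine {R : Type*} [Semiring R] (D A A' B B' : Matrix (Fin m) (Fin m) R) (hA : D * A' = A * D)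
    (hB : D * B' = B * D) (w : List Bool) : D * gword A' B' w = gword A B w * D := by
  induction w with
  | nil => rw [gword_nil, gword_nil, Matrix.mul_one, Matrix.one_mul]
  | cons b w ih =>
    rw [gword_cons, gword_cons, ← Matrix.mul_assoc]
    cases b
    · simp only [Bool.false_eq_true, ↓reduceIte]
      rw [hA, Matrix.mul_assoc, ih, ← Matrix.mul_assoc]
    · simp only [↓reduceIte]
      rw [hB, Matrix.mul_assoc, ih, ← Matrix.mul_assoc]

/-- An invertible intertwiner transports the vanishing of words. -/
theorem gword_eq_zero_iff_of_intertwine {R : Type*} [CommRing R] (D A A' B B' : Matrix (Fin m) (Fin m) R) (hD : IsUnit D)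
    (hA : D * A' = A * D) (hB : D * B' = B * D) (w : List Bool) : gword A B w = 0 ↔ gword A' B' w = 0 := by
  have h := gword_intertwine D A A' B B' hA hB w
  constructor
  · intro h0
    rw [h0, Matrix.zero_mul] at h
    exact hD.mul_left_cancel (h.trans (Matrix.mul_zero D).symm)
  · intro h0
    rw [h0, Matrix.mul_zero] at h
    exact hD.mul_right_cancel (h.symm.trans (Matrix.zero_mul D).symm)

end Words

/-! ## Lemma B: no cancellation along a directed path (`0/1` letters) -/

section LemmaB

variable {n m : ℕ}

/-- A `0/1` letter has entry `≥ 1` at the place of a coordinate carrying `1`. -/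
theorem one_le_patTop_apply_pos (pos : Fin n × Fin n → Fin m × Fin m) (v : Fin n × Fin n → ℕ) (c : Fin n × Fin n)
    (hc : 1 ≤ v c) : 1 ≤ patTop pos v (pos c).1 (pos c).2 := by
  simp only [patTop, Prod.mk.eta]
  calc 1 ≤ (if pos c = pos c then v c else 0) := by simp [hc]
    _ ≤ ∑ c', (if pos c' = pos c then v c' else 0) :=
        Finset.single_le_sum (f := fun c' => if pos c' = pos c then v c' else 0) (fun _ _ => Nat.zero_le _)
          (Finset.mem_univ c)

/-- **Lemma B over `ℕ`.**  Along a directed path `c :: l` of the placement digraph (consecutive coordinates composable), the word whose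
`i`-th letter is the `0/1` indicator top of `E` when the `i`-th edge lies in `E` and the all-ones top otherwise has entry `≥ 1` from the
tail of the first edge to the head of the last: every summand is a natural number and the path itself contributes `1`. -/
theorem one_le_gword_apply_of_isChain (pos : Fin n × Fin n → Fin m × Fin m) (E : Finset (Fin n × Fin n)) :
    ∀ (l : List (Fin n × Fin n)) (c c₁ : Fin n × Fin n), (c :: l).IsChain (fun a b => (pos a).2 = (pos b).1) →
      (c :: l).getLast? = some c₁ →
      1 ≤ gword (patTop pos fun _ => (1 : ℕ)) (patTop pos fun d => if d ∈ E then 1 else 0)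
            ((c :: l).map fun d => decide (d ∈ E)) (pos c).1 (pos c₁).2 := by
  intro l
  induction l with
  | nil =>
    intro c c₁ _ hlast
    have hc₁ : c₁ = c := by simpa using hlast.symm
    subst c₁
    rw [List.map_singleton, gword_cons, gword_nil, Matrix.mul_one]
    by_cases hc : c ∈ E
    · simp only [hc, decide_true, ↓reduceIte]
      exact one_le_patTop_apply_pos pos _ c (by simp [hc])
    · simp only [hc, decide_false, Bool.false_eq_true, ↓reduceIte]
      exact one_le_patTop_apply_pos pos _ c le_rfl
  | cons d l ih =>
    intro c c₁ hch hlast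
    rw [List.isChain_cons_cons] at hch
    obtain ⟨hcd, hrest⟩ := hch
    have hlast' : (d :: l).getLast? = some c₁ := by
      simpa [List.getLast?_cons_cons] using hlast
    have h1 := ih d c₁ hrest hlast'
    rw [List.map_cons, gword_cons, Matrix.mul_apply]
    have hletter : 1 ≤ (if decide (c ∈ E) then patTop pos (fun d => if d ∈ E then 1 else 0) else patTop pos fun _ => (1 : ℕ))
        (pos c).1 (pos c).2 := by
      by_cases hc : c ∈ E
      · simp only [hc, decide_true, ↓reduceIte]
        exact one_le_patTop_apply_pos pos _ c (by simp [hc])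
      · simp only [hc, decide_false, Bool.false_eq_true, ↓reduceIte]
        exact one_le_patTop_apply_pos pos _ c le_rfl
    calc 1 ≤ (if decide (c ∈ E) then patTop pos (fun d => if d ∈ E then 1 else 0) else patTop pos fun _ => (1 : ℕ))
              (pos c).1 (pos c).2 *
            gword (patTop pos fun _ => (1 : ℕ)) (patTop pos fun d => if d ∈ E then 1 else 0)
              ((d :: l).map fun d => decide (d ∈ E)) (pos c).2 (pos c₁).2 := by
          have hletter' : 1 ≤ (if decide (c ∈ E) then patTop pos (fun d => if d ∈ E then 1 else 0)
              else patTop pos fun _ => (1 : ℕ)) (pos c).1 (pos d).1 := hcd ▸ hletter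
          rw [hcd]
          exact one_le_mul_of_one_le_of_one_le hletter' h1
      _ ≤ _ := Finset.single_le_sum (f := fun x => (if decide (c ∈ E) then patTop pos (fun d => if d ∈ E then 1 else 0)
              else patTop pos fun _ => (1 : ℕ)) (pos c).1 x *
            gword (patTop pos fun _ => (1 : ℕ)) (patTop pos fun d => if d ∈ E then 1 else 0)
              ((d :: l).map fun d => decide (d ∈ E)) x (pos c₁).2) (fun _ _ => Nat.zero_le _) (Finset.mem_univ _)

/-- **Lemma B (complex form).**  For the all-ones top `A_D = patTop pos 1` and the indicator top `A_E` of a coordinate set `E`, the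
word read along a directed path (letter `A_E` on the edges in `E`, `A_D` elsewhere) is NONZERO. -/
theorem word_indicator_ne_zero_of_isChain (pos : Fin n × Fin n → Fin m × Fin m) (E : Finset (Fin n × Fin n))
    (l₀ : List (Fin n × Fin n)) (hl₀ : l₀ ≠ []) (hch : l₀.IsChain fun a b => (pos a).2 = (pos b).1) :
    word (patTop pos fun _ => (1 : ℂ)) (patTop pos fun d => if d ∈ E then (1 : ℂ) else 0)
      (l₀.map fun d => decide (d ∈ E)) ≠ 0 := by
  obtain ⟨c, l, rfl⟩ := List.exists_cons_of_ne_nil hl₀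
  obtain ⟨c₁, hc₁⟩ : ∃ c₁, (c :: l).getLast? = some c₁ := by
    rw [List.getLast?_eq_getLast_of_ne_nil (List.cons_ne_nil c l)]
    exact ⟨_, rfl⟩
  have h1 := one_le_gword_apply_of_isChain pos E l c c₁ hch hc₁
  intro h0
  have hcast : (gword (patTop pos fun _ => (1 : ℕ)) (patTop pos fun d => if d ∈ E then 1 else 0)
      ((c :: l).map fun d => decide (d ∈ E))).map (Nat.castRingHom ℂ) =
      word (patTop pos fun _ => (1 : ℂ)) (patTop pos fun d => if d ∈ E then (1 : ℂ) else 0)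
        ((c :: l).map fun d => decide (d ∈ E)) := by
    rw [gword_map, word_eq_gword, patTop_map, patTop_map]
    congr 2
    · funext d; simp
    · funext d; split_ifs <;> simp
  have h2 := congr_fun (congr_fun (hcast.trans h0) (pos c).1) (pos c₁).2
  simp only [Matrix.map_apply, eq_natCast, Matrix.zero_apply, Nat.cast_eq_zero] at h2
  omega

end LemmaB

/-! ## The path-placement criterion: `n` edge-disjoint directed `(n−1)`-paths kill every budget -/

section Placement

variable {s m : ℕ}

/-- The placement of a path coordinate `(a, i)`, `i < s`: the `i`-th edge of the `a`-th vertex sequence. -/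
theorem placement_apply_lt (V : Fin (s + 1) → Fin (s + 1) → Fin m) (X : Fin (s + 1) → Fin m × Fin m) (a i : Fin (s + 1))
    (hi : (i : ℕ) < s) : placement V X (a, i) = (V a ⟨i, by omega⟩, V a ⟨i + 1, by omega⟩) := by
  simp [placement, hi]

/-- The `a`-th row path `[(a,0), …, (a,s−1)]` is a directed path of the placement digraph. -/
theorem isChain_rowPath (V : Fin (s + 1) → Fin (s + 1) → Fin m) (X : Fin (s + 1) → Fin m × Fin m) (a : Fin (s + 1)) :
    (List.ofFn fun i : Fin s => ((a, i.castSucc) : Fin (s + 1) × Fin (s + 1))).IsChain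
      (fun c d => (placement V X c).2 = (placement V X d).1) := by
  rw [List.isChain_ofFn]
  intro i hi
  rw [placement_apply_lt V X a _ (by simp; omega), placement_apply_lt V X a _ (by simp; omega)]
  simp

/-- Counting the `true` letters of a row word. -/
theorem count_true_ofFn : ∀ {s : ℕ} (q : Fin s → Bool),
    (List.ofFn q).count true = (Finset.univ.filter fun i => q i = true).card
  | 0, q => by simp
  | s + 1, q => by
    rw [List.ofFn_succ, List.count_cons, count_true_ofFn (fun i => q i.succ), Finset.card_filter, Finset.card_filter,
      Fin.sum_univ_succ, add_comm]
    simp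

end Placement

end Summit.ValiantsHypothesis.ValiantsHypothesis.Theorems.GrenetZeon.RadicalSplit

end
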